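import Mathlib
import Summits.CriticalPhenomena.PercolationContinuityZ3.Theorems.PinholeClosing.Negative.PinholeClosingBaseline
import Literature.Probability.Percolation.MinOpenCut
import HarnessLib

/-!
# Crux `PercBudgetLadder.PinholeClosing` (stmt-CriticalPhenomena-5249), line `balanced-deletion` — stub `stub_budgetOneEdge`

Helper file for the crux skeleton `Cruxes/PinholeClosing/Lines/balanced_deletion.lean`
(lead prover-line-stmt-CriticalPhenomena-5249-c1-0); proves exactly the registered stub `stub_budgetOneEdge` of
that skeleton (`--supports stmt-CriticalPhenomena-5249`), one namespace down as
`Summit.CriticalPhenomena.PercolationContinuityZ3.Theorems.BalancedDeletion.stub_budgetOneEdge`.  No new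
definitions: the statement is in the tree's vocabulary (`minOpenCutIn`, `box`, `innerBoundary`, `edgesIn`,
`zdGraph`).

Informal statement (deterministic ONE-EDGE FACTS about the budget).  For the window `(n, m)` write
`B(ω) = minOpenCutIn ↑(box 3 m) ↑(box 3 n) ↑(innerBoundary (zdGraph 3) (box 3 m)) ω ∈ ℕ∞` (the least number of
edges whose closing leaves no open path inside `box 3 m` from `box 3 n` to the inner vertex boundary of
`box 3 m`).  Then for every configuration `ω` and every pair `f`:
(i) `B(ω) ≤ B(ω ∖ f) + 1`; (ii) `B(ω ∪ f) ≤ B(ω) + 1`; (iii) if `n < m` then `B(ω) < ∞`;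
(iv) if `n < m`, `ω ⊆ E(ℤ³)` and `B(ω) = j + 1`, then some OPEN lattice edge `b` inside `box 3 m` is a
bottleneck: `B(ω ∖ b) + 1 ≤ B(ω)`.

Proof route.  (i) A minimal open cutset `T` of `ω ∖ f` (`exists_eq_minOpenCutIn`) together with `f` is an open
cutset of `ω`, because `ω ∖ (T ∪ {f}) = (ω ∖ f) ∖ T`; so `B(ω) ≤ #T + 1` (`minOpenCutIn_le_card`,
`Finset.card_insert_le`).  (ii) Apply (i) to `ω ∪ f` and use `(ω ∪ f) ∖ f ⊆ ω` with the monotonicity of the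
budget in the configuration (`minOpenCutIn_mono_config`).  (iii) Every open path inside `box 3 m` from `box 3 n`
to `∂ⁱⁿ box 3 m` has at least one edge (the two sets are disjoint for `n < m`,
`notMem_box_of_mem_innerBoundary`), and that edge has both endpoints in `box 3 m`; hence the finite set
`(box 3 m).sym2` of all pairs inside the box is an open cutset of EVERY configuration
(`isOpenCutsetIn_iff_isEdgeCutsetIn_openGraph`), and `B(ω) ≤ #(box 3 m).sym2 < ∞`.  (iv) From `B(ω) ≤ j + 1`
the normal form `exists_cutset_subset_edgesIn` gives a blocking set `S ⊆ edgesIn (box 3 m)` with `#S ≤ j + 1`;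
its open part `S' = S ∩ ω` blocks as well (`ω ∖ S' = ω ∖ S`), so `#S' ≥ j + 1 > 0` (else `B(ω) ≤ j`); any
`b ∈ S'` is open, lies in `edgesIn (box 3 m)`, and `S' ∖ b` (of size `≤ j`) blocks `ω ∖ b`
(`(ω ∖ b) ∖ (S' ∖ b) = ω ∖ S'`), whence `B(ω ∖ b) ≤ j` and `B(ω ∖ b) + 1 ≤ j + 1 = B(ω)`.
(Grimmett, *Percolation* (1999), §13.1: cutsets of the open sub-network.)
-/

noncomputable section

namespace Summit.CriticalPhenomena.PercolationContinuityZ3.Theorems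

open MeasureTheory
open Literature.Probability.Percolation Literature.Probability.LatticeModels
open Summit.CriticalPhenomena.PercolationContinuityZ3.Theorems.PinholeClosing.Negative

namespace BalancedDeletion

namespace BudgetOneEdge

variable {V : Type*}

/-- **Closing one edge lowers the budget by at most one**: `MinCut(ω) ≤ MinCut(ω ∖ f) + 1` — a minimal open
cutset of `ω ∖ f` together with `f` is an open cutset of `ω`. [folklore] -/
theorem minOpenCutIn_le_sdiff_singleton_add_one (S A B : Set V) (ω : BondConfig V) (f : Sym2 V) :
    minOpenCutIn S A B ω ≤ minOpenCutIn S A B (ω \ {f}) + 1 := by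
  classical
  by_cases htop : minOpenCutIn S A B (ω \ {f}) = ⊤
  · rw [htop, top_add]
    exact le_top
  obtain ⟨T, hT, hcard⟩ := exists_eq_minOpenCutIn htop
  have hset : ω \ (↑(insert f T) : Set (Sym2 V)) = (ω \ {f}) \ ↑T := by
    ext e
    simp only [Finset.coe_insert, Set.mem_sdiff, Set.mem_insert_iff, Finset.mem_coe,
      Set.mem_singleton_iff, not_or]
    tauto
  have hins : IsOpenCutsetIn S A B ω ↑(insert f T) := by
    intro x hx y hy hxy
    rw [hset] at hxy
    exact hT x hx y hy hxy
  calc minOpenCutIn S A B ω ≤ ((insert f T).card : ℕ∞) := minOpenCutIn_le_card hins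
    _ ≤ ((T.card + 1 : ℕ) : ℕ∞) := by exact_mod_cast Finset.card_insert_le f T
    _ = minOpenCutIn S A B (ω \ {f}) + 1 := by rw [Nat.cast_add, Nat.cast_one, hcard]

/-- **Opening one edge raises the budget by at most one**: `MinCut(ω ∪ f) ≤ MinCut(ω) + 1`. [folklore] -/
theorem minOpenCutIn_insert_le_add_one (S A B : Set V) (ω : BondConfig V) (f : Sym2 V) :
    minOpenCutIn S A B (insert f ω) ≤ minOpenCutIn S A B ω + 1 := by
  have hsub : insert f ω \ {f} ⊆ ω := by
    intro e he
    simp only [Set.mem_sdiff, Set.mem_insert_iff, Set.mem_singleton_iff] at he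
    tauto
  calc minOpenCutIn S A B (insert f ω) ≤ minOpenCutIn S A B (insert f ω \ {f}) + 1 :=
        minOpenCutIn_le_sdiff_singleton_add_one S A B (insert f ω) f
    _ ≤ minOpenCutIn S A B ω + 1 := by
        gcongr
        exact minOpenCutIn_mono_config hsub

/-- **All pairs inside the box form an open cutset of every configuration** (`n < m`): an open path inside
`box 3 m` from `box 3 n` to `∂ⁱⁿ box 3 m` has a first edge, whose endpoints lie in `box 3 m`. [folklore] -/
theorem isOpenCutsetIn_sym2_box {n m : ℕ} (h : n < m) (ω : BondConfig (Site 3)) :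
    IsOpenCutsetIn (↑(box 3 m) : Set (Site 3)) ↑(box 3 n) ↑(innerBoundary (zdGraph 3) (box 3 m)) ω
      ↑((box 3 m).sym2) := by
  rw [isOpenCutsetIn_iff_isEdgeCutsetIn_openGraph]
  intro a b ha hb p
  cases p with
  | nil => exact absurd ha (notMem_box_of_mem_innerBoundary h hb)
  | cons hadj q =>
    rename_i c
    refine ⟨s(a, c), by simp, ?_⟩
    rw [Sym2.map_mk, Finset.mem_coe, Finset.mk_mem_sym2_iff]
    exact ⟨a.2, c.2⟩

/-- **The budget of a nondegenerate window is finite**: `MinCut(ω) ≤ #(box 3 m).sym2 < ∞` for `n < m` and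
every configuration `ω`. [folklore] -/
theorem minOpenCutIn_ne_top {n m : ℕ} (h : n < m) (ω : BondConfig (Site 3)) :
    minOpenCutIn (↑(box 3 m) : Set (Site 3)) ↑(box 3 n) ↑(innerBoundary (zdGraph 3) (box 3 m)) ω ≠ ⊤ :=
  ne_top_of_le_ne_top (ENat.coe_ne_top _) (minOpenCutIn_le_card (isOpenCutsetIn_sym2_box h ω))

/-- **Bottlenecks exist on `{MinCut = j + 1}`** (lattice configurations): some open lattice edge `b` inside
`box 3 m` has `MinCut(ω ∖ b) + 1 ≤ MinCut(ω)` — take `b` in the open part of a blocking set of size `≤ j + 1`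
inside `edgesIn (box 3 m)` (`exists_cutset_subset_edgesIn`). [folklore] -/
theorem exists_bneck {n m j : ℕ} {ω : BondConfig (Site 3)} (hω : ω ⊆ (zdGraph 3).edgeSet)
    (hB : minOpenCutIn (↑(box 3 m) : Set (Site 3)) ↑(box 3 n) ↑(innerBoundary (zdGraph 3) (box 3 m)) ω =
      ((j + 1 : ℕ) : ℕ∞)) :
    ∃ b ∈ edgesIn (zdGraph 3) (box 3 m), b ∈ ω ∧
      minOpenCutIn (↑(box 3 m) : Set (Site 3)) ↑(box 3 n) ↑(innerBoundary (zdGraph 3) (box 3 m)) (ω \ {b}) + 1 ≤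
        minOpenCutIn (↑(box 3 m) : Set (Site 3)) ↑(box 3 n) ↑(innerBoundary (zdGraph 3) (box 3 m)) ω := by
  classical
  have hmem : ω ∈ {ω : BondConfig (Site 3) | minOpenCutIn (↑(box 3 m) : Set (Site 3)) ↑(box 3 n)
      ↑(innerBoundary (zdGraph 3) (box 3 m)) ω ≤ (j + 1 : ℕ)} := hB.le
  rw [← blockedEv_eq_setOf_minCut] at hmem
  obtain ⟨S, hSE, hSk, hS⟩ := exists_cutset_subset_edgesIn hω hmem
  set S' : Finset (Sym2 (Site 3)) := S.filter fun e => e ∈ ω with hS'def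
  have hS'S : S' ⊆ S := Finset.filter_subset _ _
  have heq : ω \ (↑S' : Set (Sym2 (Site 3))) = ω \ ↑S := by
    ext e
    simp only [hS'def, Set.mem_sdiff, Finset.coe_filter, Set.mem_setOf_eq, Finset.mem_coe, not_and]
    tauto
  have hS'cut : IsOpenCutsetIn (↑(box 3 m) : Set (Site 3)) ↑(box 3 n) ↑(innerBoundary (zdGraph 3) (box 3 m))
      ω ↑S' := by
    intro x hx y hy hxy
    rw [heq] at hxy
    exact hS ⟨x, hx, y, hy, hxy⟩
  have hcard : ¬ S'.card ≤ j := by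
    intro hle
    have h1 := (minOpenCutIn_le_card hS'cut).trans (show ((S'.card : ℕ) : ℕ∞) ≤ (j : ℕ) by exact_mod_cast hle)
    rw [hB] at h1
    have h2 := Nat.cast_le.1 h1
    omega
  obtain ⟨b, hb⟩ := Finset.card_pos.1 (by omega : 0 < S'.card)
  have hbω : b ∈ ω := (Finset.mem_filter.1 hb).2
  refine ⟨b, hSE (hS'S hb), hbω, ?_⟩
  have hset : (ω \ {b}) \ (↑(S'.erase b) : Set (Sym2 (Site 3))) = ω \ ↑S' := by
    ext e
    by_cases hfe : e = b
    · subst hfe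
      simp [hb]
    · simp [hfe]
  have hcut' : IsOpenCutsetIn (↑(box 3 m) : Set (Site 3)) ↑(box 3 n) ↑(innerBoundary (zdGraph 3) (box 3 m))
      (ω \ {b}) ↑(S'.erase b) := by
    intro x hx y hy hxy
    rw [hset] at hxy
    exact hS'cut x hx y hy hxy
  have hle : minOpenCutIn (↑(box 3 m) : Set (Site 3)) ↑(box 3 n) ↑(innerBoundary (zdGraph 3) (box 3 m))
      (ω \ {b}) ≤ (j : ℕ) := by
    refine (minOpenCutIn_le_card hcut').trans ?_
    have h1 : (S'.erase b).card ≤ j := by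
      rw [Finset.card_erase_of_mem hb]
      have := Finset.card_le_card hS'S
      omega
    exact_mod_cast h1
  calc minOpenCutIn (↑(box 3 m) : Set (Site 3)) ↑(box 3 n) ↑(innerBoundary (zdGraph 3) (box 3 m)) (ω \ {b}) + 1
      ≤ ((j : ℕ) : ℕ∞) + 1 := by gcongr
    _ = minOpenCutIn (↑(box 3 m) : Set (Site 3)) ↑(box 3 n) ↑(innerBoundary (zdGraph 3) (box 3 m)) ω := by
        rw [hB, Nat.cast_add, Nat.cast_one]

end BudgetOneEdge

/-- **One-edge facts about the budget of the window `(n, m)`** (line `balanced-deletion`, registered stub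
`stub_budgetOneEdge`, VERBATIM signature).  With `B(ω) = minOpenCutIn ↑(box 3 m) ↑(box 3 n) ↑(∂ⁱⁿ box 3 m) ω`:
(i) `B(ω) ≤ B(ω ∖ f) + 1`; (ii) `B(ω ∪ f) ≤ B(ω) + 1`; (iii) `n < m → B(ω) ≠ ⊤`; (iv) on `{B = j + 1}` a lattice
configuration has an open bottleneck inside `edgesIn (box 3 m)`.  Assembled from
`BudgetOneEdge.minOpenCutIn_le_sdiff_singleton_add_one`, `BudgetOneEdge.minOpenCutIn_insert_le_add_one`,
`BudgetOneEdge.minOpenCutIn_ne_top`, `BudgetOneEdge.exists_bneck`. -/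
theorem stub_budgetOneEdge :
    ∀ (n m : ℕ) (ω : BondConfig (Site 3)) (f : Sym2 (Site 3)),
      (minOpenCutIn (↑(box 3 m) : Set (Site 3)) (↑(box 3 n) : Set (Site 3)) (↑(innerBoundary (zdGraph 3) (box 3 m)) : Set (Site 3)) ω ≤
        minOpenCutIn (↑(box 3 m) : Set (Site 3)) (↑(box 3 n) : Set (Site 3)) (↑(innerBoundary (zdGraph 3) (box 3 m)) : Set (Site 3)) (ω \ {f}) + 1) ∧
      (minOpenCutIn (↑(box 3 m) : Set (Site 3)) (↑(box 3 n) : Set (Site 3)) (↑(innerBoundary (zdGraph 3) (box 3 m)) : Set (Site 3)) (insert f ω) ≤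
        minOpenCutIn (↑(box 3 m) : Set (Site 3)) (↑(box 3 n) : Set (Site 3)) (↑(innerBoundary (zdGraph 3) (box 3 m)) : Set (Site 3)) ω + 1) ∧
      (n < m → minOpenCutIn (↑(box 3 m) : Set (Site 3)) (↑(box 3 n) : Set (Site 3)) (↑(innerBoundary (zdGraph 3) (box 3 m)) : Set (Site 3)) ω ≠ ⊤) ∧
      (∀ j : ℕ, n < m → ω ⊆ (zdGraph 3).edgeSet →
        minOpenCutIn (↑(box 3 m) : Set (Site 3)) (↑(box 3 n) : Set (Site 3)) (↑(innerBoundary (zdGraph 3) (box 3 m)) : Set (Site 3)) ω = ((j + 1 : ℕ) : ℕ∞) →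
        ∃ b ∈ edgesIn (zdGraph 3) (box 3 m), b ∈ ω ∧
          minOpenCutIn (↑(box 3 m) : Set (Site 3)) (↑(box 3 n) : Set (Site 3)) (↑(innerBoundary (zdGraph 3) (box 3 m)) : Set (Site 3)) (ω \ {b}) + 1 ≤
            minOpenCutIn (↑(box 3 m) : Set (Site 3)) (↑(box 3 n) : Set (Site 3)) (↑(innerBoundary (zdGraph 3) (box 3 m)) : Set (Site 3)) ω) := by
  intro n m ω f
  exact ⟨BudgetOneEdge.minOpenCutIn_le_sdiff_singleton_add_one _ _ _ ω f,
    BudgetOneEdge.minOpenCutIn_insert_le_add_one _ _ _ ω f,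
    fun h => BudgetOneEdge.minOpenCutIn_ne_top h ω,
    fun _ _ hω hB => BudgetOneEdge.exists_bneck hω hB⟩

end BalancedDeletion

end Summit.CriticalPhenomena.PercolationContinuityZ3.Theorems

end
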